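import Literature.AlgebraicGeometry.Modules.IsoOfSectionsOnBasis
import Mathlib.Algebra.Category.ModuleCat.Sheaf.Abelian
import Mathlib.Algebra.Category.Grp.Preadditive
import Mathlib.CategoryTheory.Preadditive.Biproducts
import HarnessLib

/-!
# Sections of a binary direct sum of `𝒪_X`-modules: `Γ(W, M ⊕ N) = Γ(W, M) ⊕ Γ(W, N)` (Hartshorne II, Ex. 1.9)

For a scheme `X`, `𝒪_X`-modules `M N : X.Modules` and an open `W ⊆ X`, the sections functor
`Γ(W, –)` is additive, so it carries the binary biproduct `M ⊞ N` of the abelian category `Mod(𝒪_X)`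
(Mathlib `biprod`) to the direct sum of the section modules — R. Hartshorne, *Algebraic Geometry*,
II Ex. 1.9 ("Direct sum … `U ↦ ℱ(U) ⊕ 𝒢(U)` is a sheaf … called the direct sum … it plays the role
of direct sum and of direct product in the categories of sheaves"). This file records that in the
section-level currency the tree's module files use (`φ.app W x`, `Γ(M, W)`):

* `fst_app_inl_app`, `snd_app_inr_app`, `fst_app_inr_app`, `snd_app_inl_app`,
  `inl_app_fst_app_add_inr_app_snd_app` — the biproduct identities on sections;
* **`biprodSectionsEquiv M N W : Γ(M ⊞ N, W) ≃ₗ[Γ(X, W)] Γ(M, W) × Γ(N, W)`**,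
  `x ↦ (fst x, snd x)`, inverse `(m, n) ↦ inl m + inr n`;
* `biprod_desc_app` (`(biprod.desc φ ψ)_W x = φ_W (fst x) + ψ_W (snd x)`), `biprod_lift_app_fst ∕ _snd`,
  `biprod_desc_app_inl_app ∕ _inr_app`;
* `bijective_biprod_desc_app_iff` — `(biprod.desc φ ψ)_W` is bijective iff the sum map
  `Γ(M, W) × Γ(N, W) → Γ(P, W)`, `(m, n) ↦ φ_W m + ψ_W n`, is; and
  **`isIso_biprod_desc_of_bijective`** — `biprod.desc φ ψ : M ⊞ N ⟶ P` is an isomorphism as soon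
  as the sum maps are bijective on all AFFINE opens (`Modules/IsoOfSectionsOnBasis`).

Motivation (family `hodge`, road №4, crux stmt-HodgeConjecture-26512, stub (c1Ω), route
«BLR-absolute», captain's step (H1)): the product formula for the cotangent sheaf is the statement
that `biprod.desc (dp) (dq) : p^*Ω¹_X ⊞ q^*Ω¹_Y ⟶ Ω¹_{X ×_k Y}` is an isomorphism, checked on the
sections over product charts, where it is the ring-level formula
`Literature/Algebra/Derivations/KaehlerDifferentialTensorProduct`.

Everything is proved; no named facts; no instance, no notation. Mathlib has the abstract statement
that additive functors preserve biproducts (`Functor.mapBiprod`) but the sections of `X.Modules` over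
an open are not packaged as such a functor to `ModuleCat Γ(X, W)`; the tree had no section-level
biproduct lemma (rg `biprod.*app` over `Literature/AlgebraicGeometry/Modules`: none).

## References

* R. Hartshorne, *Algebraic Geometry*, GTM 52 (1977), II Ex. 1.9 (direct sum of sheaves), II
  Prop. 1.1. [Hartshorne1977]
-/

noncomputable section

universe u

open CategoryTheory CategoryTheory.Limits AlgebraicGeometry Opposite

namespace Literature.AlgebraicGeometry.Modules

variable {X : Scheme.{u}} (M N : X.Modules) (W : X.Opens)

/-! ### The biproduct identities on sections -/

section Identities

variable {M N}

/-- `fst (inl m) = m` on sections (`inl ≫ fst = 𝟙`). [cite: Hartshorne1977, II Ex. 1.9] -/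
@[simp]
theorem fst_app_inl_app (m : Γ(M, W)) :
    (biprod.fst : M ⊞ N ⟶ M).app W ((biprod.inl : M ⟶ M ⊞ N).app W m) = m := by
  have h : (biprod.inl : M ⟶ M ⊞ N).app W ≫ (biprod.fst : M ⊞ N ⟶ M).app W = 𝟙 _ := by
    rw [← Scheme.Modules.Hom.comp_app, biprod.inl_fst, Scheme.Modules.Hom.id_app]
  simpa using ConcreteCategory.congr_hom h m

/-- `snd (inr n) = n` on sections (`inr ≫ snd = 𝟙`). [cite: Hartshorne1977, II Ex. 1.9] -/
@[simp]
theorem snd_app_inr_app (n : Γ(N, W)) :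
    (biprod.snd : M ⊞ N ⟶ N).app W ((biprod.inr : N ⟶ M ⊞ N).app W n) = n := by
  have h : (biprod.inr : N ⟶ M ⊞ N).app W ≫ (biprod.snd : M ⊞ N ⟶ N).app W = 𝟙 _ := by
    rw [← Scheme.Modules.Hom.comp_app, biprod.inr_snd, Scheme.Modules.Hom.id_app]
  simpa using ConcreteCategory.congr_hom h n

/-- `fst (inr n) = 0` on sections (`inr ≫ fst = 0`). [cite: Hartshorne1977, II Ex. 1.9] -/
@[simp]
theorem fst_app_inr_app (n : Γ(N, W)) :
    (biprod.fst : M ⊞ N ⟶ M).app W ((biprod.inr : N ⟶ M ⊞ N).app W n) = 0 := by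
  have h : (biprod.inr : N ⟶ M ⊞ N).app W ≫ (biprod.fst : M ⊞ N ⟶ M).app W = 0 := by
    rw [← Scheme.Modules.Hom.comp_app, biprod.inr_fst, Scheme.Modules.Hom.zero_app]
  simpa using ConcreteCategory.congr_hom h n

/-- `snd (inl m) = 0` on sections (`inl ≫ snd = 0`). [cite: Hartshorne1977, II Ex. 1.9] -/
@[simp]
theorem snd_app_inl_app (m : Γ(M, W)) :
    (biprod.snd : M ⊞ N ⟶ N).app W ((biprod.inl : M ⟶ M ⊞ N).app W m) = 0 := by
  have h : (biprod.inl : M ⟶ M ⊞ N).app W ≫ (biprod.snd : M ⊞ N ⟶ N).app W = 0 := by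
    rw [← Scheme.Modules.Hom.comp_app, biprod.inl_snd, Scheme.Modules.Hom.zero_app]
  simpa using ConcreteCategory.congr_hom h m

/-- `inl (fst x) + inr (snd x) = x` on sections (`fst ≫ inl + snd ≫ inr = 𝟙`).
[cite: Hartshorne1977, II Ex. 1.9] -/
theorem inl_app_fst_app_add_inr_app_snd_app (x : Γ(M ⊞ N, W)) :
    (biprod.inl : M ⟶ M ⊞ N).app W ((biprod.fst : M ⊞ N ⟶ M).app W x) +
      (biprod.inr : N ⟶ M ⊞ N).app W ((biprod.snd : M ⊞ N ⟶ N).app W x) = x := by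
  have h := congrArg (fun φ : M ⊞ N ⟶ M ⊞ N => φ.app W) (biprod.total : _ = 𝟙 (M ⊞ N))
  simp only [Scheme.Modules.Hom.add_app, Scheme.Modules.Hom.comp_app,
    Scheme.Modules.Hom.id_app] at h
  have hx := ConcreteCategory.congr_hom h x
  rw [AddCommGrpCat.hom_add_apply] at hx
  simpa using hx

end Identities

/-! ### The section module of a biproduct -/

/-- **`Γ(W, M ⊕ N) = Γ(W, M) ⊕ Γ(W, N)`** (Hartshorne II Ex. 1.9): the `Γ(X, W)`-linear isomorphism
`x ↦ (fst x, snd x)` with inverse `(m, n) ↦ inl m + inr n`. [cite: Hartshorne1977, II Ex. 1.9] -/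
def biprodSectionsEquiv : Γ(M ⊞ N, W) ≃ₗ[Γ(X, W)] Γ(M, W) × Γ(N, W) where
  toFun x := ((biprod.fst : M ⊞ N ⟶ M).app W x, (biprod.snd : M ⊞ N ⟶ N).app W x)
  map_add' x y := by
    simp only [Prod.mk_add_mk, Prod.mk.injEq]
    exact ⟨map_add ((biprod.fst : M ⊞ N ⟶ M).app W).hom x y,
      map_add ((biprod.snd : M ⊞ N ⟶ N).app W).hom x y⟩
  map_smul' r x := by
    simp only [RingHom.id_apply, Prod.smul_mk, Scheme.Modules.Hom.app_smul]
  invFun p := (biprod.inl : M ⟶ M ⊞ N).app W p.1 + (biprod.inr : N ⟶ M ⊞ N).app W p.2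
  left_inv x := inl_app_fst_app_add_inr_app_snd_app W x
  right_inv p := by
    obtain ⟨m, n⟩ := p
    simp only [Prod.mk.injEq]
    constructor
    · rw [map_add ((biprod.fst : M ⊞ N ⟶ M).app W).hom]
      change (biprod.fst : M ⊞ N ⟶ M).app W _ + (biprod.fst : M ⊞ N ⟶ M).app W _ = m
      rw [fst_app_inl_app, fst_app_inr_app, add_zero]
    · rw [map_add ((biprod.snd : M ⊞ N ⟶ N).app W).hom]
      change (biprod.snd : M ⊞ N ⟶ N).app W _ + (biprod.snd : M ⊞ N ⟶ N).app W _ = n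
      rw [snd_app_inl_app, snd_app_inr_app, zero_add]

/-- `biprodSectionsEquiv x = (fst x, snd x)`. [cite: Hartshorne1977, II Ex. 1.9] -/
@[simp]
theorem biprodSectionsEquiv_apply (x : Γ(M ⊞ N, W)) :
    biprodSectionsEquiv M N W x =
      ((biprod.fst : M ⊞ N ⟶ M).app W x, (biprod.snd : M ⊞ N ⟶ N).app W x) := rfl

/-- `biprodSectionsEquiv.symm (m, n) = inl m + inr n`. [cite: Hartshorne1977, II Ex. 1.9] -/
@[simp]
theorem biprodSectionsEquiv_symm_apply (p : Γ(M, W) × Γ(N, W)) :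
    (biprodSectionsEquiv M N W).symm p =
      (biprod.inl : M ⟶ M ⊞ N).app W p.1 + (biprod.inr : N ⟶ M ⊞ N).app W p.2 := rfl

/-- The sections of `M ⊞ N` over `W` are the sums `inl m + inr n`. [cite: Hartshorne1977, II Ex. 1.9] -/
theorem biprod_sections_surjective :
    Function.Surjective fun p : Γ(M, W) × Γ(N, W) =>
      (biprod.inl : M ⟶ M ⊞ N).app W p.1 + (biprod.inr : N ⟶ M ⊞ N).app W p.2 :=
  (biprodSectionsEquiv M N W).symm.surjective

/-! ### Morphisms out of and into a biproduct, on sections -/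

section Desc

variable {M N} {P : X.Modules}

/-- `(biprod.desc φ ψ)_W x = φ_W (fst x) + ψ_W (snd x)` (`desc φ ψ = fst ≫ φ + snd ≫ ψ`).
[cite: Hartshorne1977, II Ex. 1.9] -/
theorem biprod_desc_app (φ : M ⟶ P) (ψ : N ⟶ P) (x : Γ(M ⊞ N, W)) :
    (biprod.desc φ ψ).app W x =
      φ.app W ((biprod.fst : M ⊞ N ⟶ M).app W x) + ψ.app W ((biprod.snd : M ⊞ N ⟶ N).app W x) := by
  have h := congrArg (fun χ : M ⊞ N ⟶ P => χ.app W) (biprod.desc_eq (f := φ) (g := ψ))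
  simp only [Scheme.Modules.Hom.add_app, Scheme.Modules.Hom.comp_app] at h
  have hx := ConcreteCategory.congr_hom h x
  rw [AddCommGrpCat.hom_add_apply] at hx
  simpa using hx

/-- `(biprod.desc φ ψ)_W (inl m) = φ_W m`. [cite: Hartshorne1977, II Ex. 1.9] -/
@[simp]
theorem biprod_desc_app_inl_app (φ : M ⟶ P) (ψ : N ⟶ P) (m : Γ(M, W)) :
    (biprod.desc φ ψ).app W ((biprod.inl : M ⟶ M ⊞ N).app W m) = φ.app W m := by
  rw [← CategoryTheory.comp_apply, ← Scheme.Modules.Hom.comp_app, biprod.inl_desc]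

/-- `(biprod.desc φ ψ)_W (inr n) = ψ_W n`. [cite: Hartshorne1977, II Ex. 1.9] -/
@[simp]
theorem biprod_desc_app_inr_app (φ : M ⟶ P) (ψ : N ⟶ P) (n : Γ(N, W)) :
    (biprod.desc φ ψ).app W ((biprod.inr : N ⟶ M ⊞ N).app W n) = ψ.app W n := by
  rw [← CategoryTheory.comp_apply, ← Scheme.Modules.Hom.comp_app, biprod.inr_desc]

/-- `(biprod.desc φ ψ)_W (inl m + inr n) = φ_W m + ψ_W n`: on sections `biprod.desc` is the sum
map through `biprodSectionsEquiv`. [cite: Hartshorne1977, II Ex. 1.9] -/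
theorem biprod_desc_app_symm (φ : M ⟶ P) (ψ : N ⟶ P) (p : Γ(M, W) × Γ(N, W)) :
    (biprod.desc φ ψ).app W ((biprodSectionsEquiv M N W).symm p) = φ.app W p.1 + ψ.app W p.2 := by
  rw [biprodSectionsEquiv_symm_apply, map_add ((biprod.desc φ ψ).app W).hom]
  change (biprod.desc φ ψ).app W _ + (biprod.desc φ ψ).app W _ = _
  rw [biprod_desc_app_inl_app, biprod_desc_app_inr_app]

/-- `fst ((biprod.lift f g)_W y) = f_W y`. [cite: Hartshorne1977, II Ex. 1.9] -/
@[simp]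
theorem biprod_lift_app_fst (f : P ⟶ M) (g : P ⟶ N) (y : Γ(P, W)) :
    (biprod.fst : M ⊞ N ⟶ M).app W ((biprod.lift f g).app W y) = f.app W y := by
  rw [← CategoryTheory.comp_apply, ← Scheme.Modules.Hom.comp_app, biprod.lift_fst]

/-- `snd ((biprod.lift f g)_W y) = g_W y`. [cite: Hartshorne1977, II Ex. 1.9] -/
@[simp]
theorem biprod_lift_app_snd (f : P ⟶ M) (g : P ⟶ N) (y : Γ(P, W)) :
    (biprod.snd : M ⊞ N ⟶ N).app W ((biprod.lift f g).app W y) = g.app W y := by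
  rw [← CategoryTheory.comp_apply, ← Scheme.Modules.Hom.comp_app, biprod.lift_snd]

/-- **`(biprod.desc φ ψ)_W` is bijective iff the sum map `(m, n) ↦ φ_W m + ψ_W n` is.**
[cite: Hartshorne1977, II Ex. 1.9] -/
theorem bijective_biprod_desc_app_iff (φ : M ⟶ P) (ψ : N ⟶ P) :
    Function.Bijective ((biprod.desc φ ψ).app W) ↔
      Function.Bijective fun p : Γ(M, W) × Γ(N, W) => φ.app W p.1 + ψ.app W p.2 := by
  have hcomp : (fun p : Γ(M, W) × Γ(N, W) => φ.app W p.1 + ψ.app W p.2) =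
      (biprod.desc φ ψ).app W ∘ (biprodSectionsEquiv M N W).symm := by
    funext p
    exact (biprod_desc_app_symm W φ ψ p).symm
  rw [hcomp, Function.Bijective.of_comp_iff _ (biprodSectionsEquiv M N W).symm.bijective]

/-- **`biprod.desc φ ψ : M ⊞ N ⟶ P` is an isomorphism if the sum maps
`Γ(M, V) × Γ(N, V) → Γ(P, V)` are bijective on all affine opens `V`** (bijective on a basis ⇒ iso,
`Modules/IsoOfSectionsOnBasis`). [cite: Hartshorne1977, II Prop. 1.1] -/
theorem isIso_biprod_desc_of_bijective (φ : M ⟶ P) (ψ : N ⟶ P)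
    (h : ∀ V : X.Opens, IsAffineOpen V →
      Function.Bijective fun p : Γ(M, V) × Γ(N, V) => φ.app V p.1 + ψ.app V p.2) :
    IsIso (biprod.desc φ ψ) :=
  isIso_of_bijective_app_of_isAffineOpen _ fun V hV => (bijective_biprod_desc_app_iff V φ ψ).mpr (h V hV)

/-- Same with bijectivity asked only on a basis of opens `B`. [cite: Hartshorne1977, II Prop. 1.1] -/
theorem isIso_biprod_desc_of_bijective_on_basis (φ : M ⟶ P) (ψ : N ⟶ P) {B : Set X.Opens}
    (hB : TopologicalSpace.Opens.IsBasis B)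
    (h : ∀ V ∈ B, Function.Bijective fun p : Γ(M, V) × Γ(N, V) => φ.app V p.1 + ψ.app V p.2) :
    IsIso (biprod.desc φ ψ) :=
  isIso_of_bijective_on_basis _ hB fun V hV => (bijective_biprod_desc_app_iff V φ ψ).mpr (h V hV)

end Desc

end Literature.AlgebraicGeometry.Modules

end
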